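import Summits.KontsevichZagierPeriods.KontsevichZagierPeriods.Theorems.LiouvilleUnfoldingAyoubPiLocalKernelRing
import Summits.KontsevichZagierPeriods.KontsevichZagierPeriods.Theorems.InverseLandauTateLiftingDimZeroRing
import Literature.NumberTheory.Transcendental.LindemannWeierstrassProofs
import Literature.NumberTheory.Transcendental.SemialgebraicAlgebraicPoints
import Mathlib.RingTheory.Algebraic.Integral
import Mathlib.Algebra.Polynomial.Lifts

/-!
# The constants-and-disc sector of item stmt-KontsevichZagierPeriods-0541
# (`LiouvilleUnfolding.AyoubPiLocalKernel`): `evalP` is injective on `K₀[ϖ]`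

Support file (`--supports` stmt-KontsevichZagierPeriods-0541) for the line `SketchIdeator2` (card
`nilradical-cut`), stub `evalP_injective_on_constants_adjoin_piClass` (wave W1).  Notation:
`P := KZ.FormalPeriodRing = FormalRep ⧸ relations` (commutative; `KZRulesAssociator.lean`),
`ϖ := KZ.toFormalPeriod (KZ.of KZ.piRep)` the class of the disc (`evalP ϖ = π`, `KZ.piRep_value`),
`evalP : P →+* ℝ` the evaluation, `K₀ ⊆ P` the subring generated by the classes `⟦[b]⟧` of the
representations `b : KZ.IntegralRep 0` over the point `ℝ⁰` (real-algebraic constants).  The crux (Ayoub's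
Conjecture 7 for the four-move calculus) says that every class of value `0` is killed by a power of `ϖ`;
its transcendence half `stub_nilLocalKernel` is of period-conjecture strength.  This file proves an
UNCONDITIONAL SECTOR of it, with exponent `0`:

  `evalP_injective_on_constants_adjoin_piClass` — for every polynomial `p ∈ P[X]` whose coefficients are
  classes `⟦[r_k]⟧` of dimension-zero representations `r_k : KZ.IntegralRep 0`,
  `evalP (p(ϖ)) = 0 → p(ϖ) = 0` (indeed `p = 0`).

Proof.  (1) The dimension-zero ring (`InverseLandau.tateLifting_dimZeroRing`, landed for item
stmt-9129): on `K₀` the value `evalP x` is ALGEBRAIC over `ℚ` (a `ℚ`-semialgebraic integrand at the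
vacuously algebraic point of `ℝ⁰`) and `evalP` is injective (`value r = 0` forces `[r] ∈ relations`).
(2) `evalP` is a ring map, so `evalP (p(ϖ)) = (p.map evalP)(π)` (`Polynomial.eval₂_at_apply`).  (3) The
coefficients `evalP ⟦[r_k]⟧` lie in the subalgebra `K := Subalgebra.algebraicClosure ℚ ℝ` of real algebraic
numbers, so `p.map evalP = q.map (K → ℝ)` for some `q ∈ K[X]` (`Polynomial.lifts_iff_coeff_lifts`), and
`aeval π q = 0`; since `π` is transcendental over `ℚ` (Lindemann 1882, `transcendental_pi_holds`), hence
over `K` (`Transcendental.subalgebraAlgebraicClosure`), `q = 0`.  So every `evalP (p.coeff k) = 0`, every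
`p.coeff k = 0` by (1), `p = 0` and `p(ϖ) = 0`.

References: F. Lindemann, *Über die Zahl π*, Math. Ann. 20 (1882), 213–225; M. Kontsevich, D. Zagier,
*Periods* (2001), §1.1 ("rational" may be replaced by "algebraic"), §4.1; J. Ayoub, EMS Newsl. 91 (2014),
Conj. 7.  Mathlib: `Subalgebra.algebraicClosure`, `Transcendental.subalgebraAlgebraicClosure`,
`Polynomial.lifts_iff_coeff_lifts`, `Polynomial.mem_lifts`, `Polynomial.eval₂_at_apply`.  No definition
is introduced and nothing conjecture-grade is asserted.
-/

noncomputable section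

open Literature.NumberTheory.Transcendental

namespace Summit.KontsevichZagierPeriods.LiouvilleUnfolding.NilradicalCut

open Summit.KontsevichZagierPeriods.LiouvilleUnfolding.PiLocalKernelPosition
open Summit.KontsevichZagierPeriods.InverseLandau (tateLifting_dimZeroRing)

/-- **Constants-and-disc sector of Ayoub's localised conjecture (exponent `0`).**  If `p ∈ P[X]` has
coefficients classes of dimension-zero representations (real-algebraic constants) and `evalP (p(ϖ)) = 0`,
`ϖ = ⟦[π]⟧` the class of the disc, then `p(ϖ) = 0` — indeed `p = 0`: `evalP (p(ϖ)) = (p.map evalP)(π)`,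
the coefficients `evalP ⟦[r_k]⟧` are real algebraic numbers, and `π` is transcendental over the real
algebraic numbers (Lindemann; `Transcendental.subalgebraAlgebraicClosure`), so every `evalP (p.coeff k) = 0`,
whence every `p.coeff k = 0` (`evalP` is injective on the dimension-zero ring,
`InverseLandau.tateLifting_dimZeroRing`). [cite: Lindemann1882MathAnn] -/
theorem evalP_injective_on_constants_adjoin_piClass : ∀ p : Polynomial KZ.FormalPeriodRing, (∀ k : ℕ, ∃ r : KZ.IntegralRep 0, p.coeff k = KZ.toFormalPeriod (KZ.of r)) → KZ.evalP (p.eval (KZ.toFormalPeriod (KZ.of KZ.piRep))) = 0 → p.eval (KZ.toFormalPeriod (KZ.of KZ.piRep)) = 0 := by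
  intro p hp h0
  -- every coefficient lies in the ring `K₀` generated by the dimension-zero classes
  have hmem : ∀ k : ℕ, p.coeff k ∈
      Subring.closure (Set.range fun b : KZ.IntegralRep 0 => KZ.toFormalPeriod (KZ.of b)) := by
    intro k
    obtain ⟨r, hr⟩ := hp k
    exact Subring.subset_closure ⟨r, hr.symm⟩
  -- `evalP` is a ring map with `evalP ϖ = π`: `evalP (p(ϖ)) = (p.map evalP)(π)`
  have hπ : KZ.evalP (KZ.toFormalPeriod (KZ.of KZ.piRep)) = Real.pi := by
    rw [KZ.evalP_toFormalPeriod_of, KZ.piRep_value]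
  have heval : (p.map KZ.evalP).eval Real.pi = 0 := by
    rw [Polynomial.eval_map, ← hπ, Polynomial.eval₂_at_apply, h0]
  -- the coefficients `evalP (p.coeff k)` are real algebraic numbers: lift `p.map evalP` to `K[X]`
  set K : Subalgebra ℚ ℝ := Subalgebra.algebraicClosure ℚ ℝ with hK
  have hlifts : p.map KZ.evalP ∈ Polynomial.lifts (algebraMap K ℝ) := by
    rw [Polynomial.lifts_iff_coeff_lifts]
    intro n
    rw [Polynomial.coeff_map]
    exact ⟨⟨KZ.evalP (p.coeff n), (Subalgebra.mem_algebraicClosure ℚ ℝ).mpr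
      (tateLifting_dimZeroRing _ (hmem n)).2.1⟩, rfl⟩
  obtain ⟨q, hq⟩ := (Polynomial.mem_lifts _).mp hlifts
  -- `π` is transcendental over `K` (Lindemann), so the lift `q` vanishes
  have hT : Transcendental ℚ Real.pi := transcendental_pi_holds
  have hTK : Transcendental K Real.pi := hT.subalgebraAlgebraicClosure
  have hq0 : q = 0 := by
    by_contra hne
    refine hTK ⟨q, hne, ?_⟩
    rw [Polynomial.aeval_def, ← Polynomial.eval_map, hq, heval]
  have hmap : p.map KZ.evalP = 0 := by rw [← hq, hq0, Polynomial.map_zero]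
  -- hence every `evalP (p.coeff k) = 0`, every `p.coeff k = 0`, and `p = 0`
  have hp0 : p = 0 := by
    ext k
    have hk : KZ.evalP (p.coeff k) = 0 := by
      rw [← Polynomial.coeff_map, hmap, Polynomial.coeff_zero]
    rw [Polynomial.coeff_zero]
    exact (tateLifting_dimZeroRing _ (hmem k)).2.2 hk
  rw [hp0, Polynomial.eval_zero]

end Summit.KontsevichZagierPeriods.LiouvilleUnfolding.NilradicalCut

end
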